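import Summits.QuantumFields.BalabanUV.Beta.SecondOrderBorderNoModel
import Summits.QuantumFields.BalabanUV.Beta.SpineRecursivePureLaws
import Summits.QuantumFields.BalabanUV.Beta.SpineRecursiveInductive

/-!
# `BalabanUV.Beta.SecondOrderBorderGauge` — binder row D1, (L4): THE GAUGE FORM OF THE CANONICAL SECOND-ORDER CONTACT, THE REFLECTION ACTION
# ON (BI-)TABLES, AND THE SINGLE-AXIS MODEL OF THE BORDER LETTER (β sub-cell, row BETA-an2 = BINDER-OWNERS row D1 OWNER, lineage an2 gen 20, K-L1)

HONEST FRAMING (cell charter, verbatim): «discharging BetaPertH makes Balaban's UV stability UNCONDITIONAL — a real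
constructive-QFT result; it is NOT the continuum limit and NOT the Clay problem.»  Neutral kernel algebra ([folklore]), entrywise; no statement
of Bałaban's papers, no `[cite:]`, no `Prop` fact; instantiates no binder of the wall.  NOT D1, NOT `BetaPertH`, NOT continuum, NOT Clay.

The hR END OF RECORD `SpineRooted.…_JsRecWAtOf_of_an1_letters` (`SpineRecursiveT2AllSockets`, an2 gen 19) takes the BORDER LETTER (hBe) as a
hypothesis: an exact `fm`-entrywise reflection law of an anti-twin border table against the CANONICAL contact `conjW 𝕄 S S′ X X′ (X∘X′)`.
* §1 `conjW_canon_apply`: with diagonal generators and the canonical second symbol the contact is the ENTRYWISE multiplier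
  `V′·Δg + V·Δg′ + 𝕄·Δg·Δg′` (`Δg := g(z,b) − g(x,a)`) — the `τ₁τ₂`-coefficient of the diagonal gauge conjugate `e^{Δ(τ₁g+τ₂g′)}(𝕄+τ₁V+τ₂V′+τ₁τ₂T)`.
* §2 the reflection ACTION of axis `α` on stencil families (`actS`) and on bi-tables (`actB`): involutions, additive, homogeneous.
* §3 `actS_eq_of_law` (a first-order law `S κ (bref u) = ε • refK (S κ u + C κ u)` is `actS S = S + C`); **`letter_iff_actB`**: the END's border
  letter for `G` against `D` (entrywise, any leg pair) is EQUIVALENT to `actB G − G = D` there.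
* §4 `canonD 𝕄 S g` (the canonical contact of a first-order datum); under the first-order law it reads `S′·Δg + (actS S)·Δg′`; **`actB_canonD`**:
  with an `α`-ODD generator, `actB (canonD) = −canonD` — ANTI-INVARIANCE, using nothing about `𝕄` beyond the first-order law.
* §5 **`single_axis_model`** (`T := −½ • D` solves `actB T − T = D` when `actB D = −D`) and `solution_iff` (all solutions = `T +` invariants).
* NOT HERE: the wall's level-0 instance (`SecondOrderBorderGaugeWall`); one table for all four axes, its classes, the END corollary (K-L2).
HONEST: a model of the socket is NOT an identification of Bałaban's second-order border jet (= an1's letter); 0∕4 binders.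
Provenance: β sub-cell, unit beta-an2 gen 20, 2026-08-20 (v1); no existing file touched.
-/

open Finset
open scoped BigOperators
open Literature.MathematicalPhysics.QuantumFieldTheory
open Literature.MathematicalPhysics.QuantumFieldTheory.Balaban1983to89
open Literature.MathematicalPhysics.QuantumFieldTheory.Balaban1983to89.Beta
open ExpKernelCalculus (MKer)
open AffineAveraging (box toSite)
open AveragingContoursRooted (ctr ctrOff ctrOff_mem_box)
open PolarizationSign (reflSign)
open KernelReflection (LegMap refK refK_apply)
open ResolventReflection (sref bref bref_bref bref_apply mref mref_mref mref_zsmul Φ Φ_r_inl Φ_r_inr Φ_s_inl Φ_s_inr reflSign_mul_self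
  reflSign_self reflSign_of_ne)
open OneStepResolventKernel (Fib)
open Summit.QuantumFields.BalabanUV.Beta.TameKernelCalculus
open Summit.QuantumFields.BalabanUV.Beta.ChartConjugation (conjV conjW)
open Summit.QuantumFields.BalabanUV.Beta.BorderedHessian (diagK diagK_apply ctGen ctGen_inl ctGen_inr bhKStepAt bhKStepAt_zero stepScale
  conjV_diagK_apply)
open Summit.QuantumFields.BalabanUV.Beta.SecondOrderStepLaw (conjW_diag_apply)
open Summit.QuantumFields.BalabanUV.Beta.E3LevelOneReflection (refK_add refK_smul refK_sub refK_Φ_refK_Φ Φ_r_r)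
open Summit.QuantumFields.BalabanUV.Beta.VertexReflectionContact (refK_neg smul_diagK)

namespace Summit.QuantumFields.BalabanUV.Beta.SecondOrderBorderGauge

noncomputable section

variable {d : ℕ}

/-! ## §1 The gauge form of the canonical contact -/

/-- [folklore] **THE CANONICAL SECOND-ORDER CONTACT IS AN ENTRYWISE MULTIPLIER**: with diagonal generators and the canonical second symbol
`g·g′`, `conjW 𝕄 V V′ (diagK g) (diagK g′) (diagK (g·g′)) x z a b = V′·Δg + V·Δg′ + 𝕄·Δg·Δg′`, `Δg := g z b − g x a`. -/
theorem conjW_canon_apply (M V V' : MKer (d + 1) (Fib d)) (g g' : (Fin (d + 1) → ℤ) → Fib d → ℝ) (x z : Fin (d + 1) → ℤ) (a b : Fib d) :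
    conjW M V V' (diagK g) (diagK g') (diagK fun p c => g p c * g' p c) x z a b =
      V' x z a b * (g z b - g x a) + V x z a b * (g' z b - g' x a) + M x z a b * ((g z b - g x a) * (g' z b - g' x a)) := by
  rw [conjW_diag_apply]; ring

/-! ## §2 The reflection action on stencil families and on bi-tables -/

/-- [our object] **THE ACTION OF THE AXIS-`α` REFLECTION ON A STENCIL FAMILY** (tables indexed by one jet bond `(κ, u)`):
`actS N α S κ u := ε_κ • refK (Φ N α) (S κ (bref α κ u))`. -/
def actS (N : ℕ) (α : Fin (d + 1)) (S : Fin (d + 1) → (Fin (d + 1) → ℤ) → MKer (d + 1) (Fib d)) : Fin (d + 1) → (Fin (d + 1) → ℤ) → MKer (d + 1) (Fib d) :=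
  fun κ u => reflSign α κ • refK (Φ (d := d) N α) (S κ (bref α κ u))

/-- [our object] **THE ACTION OF THE AXIS-`α` REFLECTION ON A BI-TABLE** (tables indexed by two jet bonds):
`actB N α F κ u κ′ u′ := (ε_κ ε_κ′) • refK (Φ N α) (F κ (bref α κ u) κ′ (bref α κ′ u′))`. -/
def actB (N : ℕ) (α : Fin (d + 1)) (F : Fin (d + 1) → (Fin (d + 1) → ℤ) → Fin (d + 1) → (Fin (d + 1) → ℤ) → MKer (d + 1) (Fib d)) : Fin (d + 1) → (Fin (d + 1) → ℤ) → Fin (d + 1) → (Fin (d + 1) → ℤ) → MKer (d + 1) (Fib d) :=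
  fun κ u κ' u' => (reflSign α κ * reflSign α κ') • refK (Φ (d := d) N α) (F κ (bref α κ u) κ' (bref α κ' u'))

variable (N : ℕ) (α : Fin (d + 1))

/-- [folklore] Entries of `actS`. -/
theorem actS_apply (S : Fin (d + 1) → (Fin (d + 1) → ℤ) → MKer (d + 1) (Fib d)) (κ : Fin (d + 1)) (u x z : Fin (d + 1) → ℤ) (a b : Fib d) :
    actS N α S κ u x z a b = reflSign α κ * ((Φ (d := d) N α).s a * (Φ (d := d) N α).s b *
      S κ (bref α κ u) ((Φ (d := d) N α).r a x) ((Φ (d := d) N α).r b z) a b) := by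
  simp only [actS, Pi.smul_apply, smul_eq_mul, refK_apply]

/-- [folklore] Entries of `actB`. -/
theorem actB_apply (F : Fin (d + 1) → (Fin (d + 1) → ℤ) → Fin (d + 1) → (Fin (d + 1) → ℤ) → MKer (d + 1) (Fib d)) (κ : Fin (d + 1)) (u : Fin (d + 1) → ℤ) (κ' : Fin (d + 1)) (u' x z : Fin (d + 1) → ℤ) (a b : Fib d) :
    actB N α F κ u κ' u' x z a b = reflSign α κ * reflSign α κ' * ((Φ (d := d) N α).s a * (Φ (d := d) N α).s b *
      F κ (bref α κ u) κ' (bref α κ' u') ((Φ (d := d) N α).r a x) ((Φ (d := d) N α).r b z) a b) := by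
  simp only [actB, Pi.smul_apply, smul_eq_mul, refK_apply]

/-- [folklore] `actS` is an involution. -/
theorem actS_actS (S : Fin (d + 1) → (Fin (d + 1) → ℤ) → MKer (d + 1) (Fib d)) : actS N α (actS N α S) = S := by
  funext κ u
  show reflSign α κ • refK (Φ (d := d) N α) (reflSign α κ • refK (Φ (d := d) N α) (S κ (bref α κ (bref α κ u)))) = S κ u
  rw [refK_smul, smul_smul, reflSign_mul_self, one_smul, bref_bref, refK_Φ_refK_Φ]

/-- [folklore] `actB` is an involution. -/
theorem actB_actB (F : Fin (d + 1) → (Fin (d + 1) → ℤ) → Fin (d + 1) → (Fin (d + 1) → ℤ) → MKer (d + 1) (Fib d)) : actB N α (actB N α F) = F := by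
  funext κ u κ' u'
  show (reflSign α κ * reflSign α κ') • refK (Φ (d := d) N α) ((reflSign α κ * reflSign α κ') •
    refK (Φ (d := d) N α) (F κ (bref α κ (bref α κ u)) κ' (bref α κ' (bref α κ' u')))) = F κ u κ' u'
  rw [refK_smul, smul_smul, bref_bref, bref_bref, refK_Φ_refK_Φ,
    show reflSign α κ * reflSign α κ' * (reflSign α κ * reflSign α κ') = (reflSign α κ * reflSign α κ) * (reflSign α κ' * reflSign α κ') by ring,
    reflSign_mul_self, reflSign_mul_self, one_mul, one_smul]

/-- [folklore] `actB` is additive. -/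
theorem actB_add (F G : Fin (d + 1) → (Fin (d + 1) → ℤ) → Fin (d + 1) → (Fin (d + 1) → ℤ) → MKer (d + 1) (Fib d)) : actB N α (F + G) = actB N α F + actB N α G := by
  funext κ u κ' u'
  show (reflSign α κ * reflSign α κ') • refK (Φ (d := d) N α) (F κ (bref α κ u) κ' (bref α κ' u') + G κ (bref α κ u) κ' (bref α κ' u')) = _
  rw [refK_add, smul_add]; rfl

/-- [folklore] `actB` is homogeneous. -/
theorem actB_smul (c : ℝ) (F : Fin (d + 1) → (Fin (d + 1) → ℤ) → Fin (d + 1) → (Fin (d + 1) → ℤ) → MKer (d + 1) (Fib d)) : actB N α (c • F) = c • actB N α F := by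
  funext κ u κ' u'
  show (reflSign α κ * reflSign α κ') • refK (Φ (d := d) N α) (c • F κ (bref α κ u) κ' (bref α κ' u')) = c • actB N α F κ u κ' u'
  rw [refK_smul, smul_comm]; rfl

/-- [folklore] `actB` commutes with negation. -/
theorem actB_neg (F : Fin (d + 1) → (Fin (d + 1) → ℤ) → Fin (d + 1) → (Fin (d + 1) → ℤ) → MKer (d + 1) (Fib d)) : actB N α (-F) = -actB N α F := by
  rw [show -F = (-1 : ℝ) • F by simp, actB_smul, neg_one_smul]

/-- [folklore] `actB` is subtractive. -/
theorem actB_sub (F G : Fin (d + 1) → (Fin (d + 1) → ℤ) → Fin (d + 1) → (Fin (d + 1) → ℤ) → MKer (d + 1) (Fib d)) : actB N α (F - G) = actB N α F - actB N α G := by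
  rw [sub_eq_add_neg, actB_add, actB_neg, ← sub_eq_add_neg]

/-! ## §3 Laws in action form -/

/-- [folklore] **A FIRST-ORDER LAW IN ACTION FORM**: `S κ (bref u) = ε_κ • refK (S κ u + C κ u)` for all `κ u` gives `actS S = S + C`. -/
theorem actS_eq_of_law {S C : Fin (d + 1) → (Fin (d + 1) → ℤ) → MKer (d + 1) (Fib d)} (hS : ∀ κ u, S κ (bref α κ u) = reflSign α κ • refK (Φ (d := d) N α) (S κ u + C κ u)) :
    actS N α S = fun κ u => S κ u + C κ u := by
  funext κ u
  show reflSign α κ • refK (Φ (d := d) N α) (S κ (bref α κ u)) = S κ u + C κ u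
  rw [hS κ u, refK_smul, smul_smul, reflSign_mul_self, one_smul, refK_Φ_refK_Φ]

/-- [folklore] **THE BORDER LETTER IN ACTION FORM** (any leg pair `(a, b)`, fixed jet bonds): the END's entrywise law
`G κ (bref u) κ′ (bref u′) =ab= (ε_κ ε_κ′) • refK (G κ u κ′ u′ + D κ u κ′ u′)` is EQUIVALENT to `actB G − G =ab= D`. -/
theorem letter_iff_actB (G D : Fin (d + 1) → (Fin (d + 1) → ℤ) → Fin (d + 1) → (Fin (d + 1) → ℤ) → MKer (d + 1) (Fib d)) (κ : Fin (d + 1)) (u : Fin (d + 1) → ℤ) (κ' : Fin (d + 1)) (u' : Fin (d + 1) → ℤ) (a b : Fib d) :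
    (∀ x z : Fin (d + 1) → ℤ, G κ (bref α κ u) κ' (bref α κ' u') x z a b =
        ((reflSign α κ * reflSign α κ') • refK (Φ (d := d) N α) (G κ u κ' u' + D κ u κ' u')) x z a b) ↔
      (∀ x z : Fin (d + 1) → ℤ, (actB N α G κ u κ' u' - G κ u κ' u') x z a b = D κ u κ' u' x z a b) := by
  have hsa := (Φ (d := d) N α).s_mul_s a
  have hsb := (Φ (d := d) N α).s_mul_s b
  have hκ := reflSign_mul_self α κ
  have hκ' := reflSign_mul_self α κ'
  constructor
  · intro h x z
    have e := h ((Φ (d := d) N α).r a x) ((Φ (d := d) N α).r b z)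
    simp only [Pi.smul_apply, Pi.add_apply, smul_eq_mul, refK_apply, Φ_r_r] at e
    rw [Pi.sub_apply, Pi.sub_apply, Pi.sub_apply, Pi.sub_apply, actB_apply, e]
    linear_combination ((G κ u κ' u' x z a b + D κ u κ' u' x z a b) * ((reflSign α κ' * reflSign α κ') *
      (((Φ (d := d) N α).s a * (Φ (d := d) N α).s a) * ((Φ (d := d) N α).s b * (Φ (d := d) N α).s b)))) * hκ +
      ((G κ u κ' u' x z a b + D κ u κ' u' x z a b) * (((Φ (d := d) N α).s a * (Φ (d := d) N α).s a) *
        ((Φ (d := d) N α).s b * (Φ (d := d) N α).s b))) * hκ' +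
      ((G κ u κ' u' x z a b + D κ u κ' u' x z a b) * ((Φ (d := d) N α).s b * (Φ (d := d) N α).s b)) * hsa +
      (G κ u κ' u' x z a b + D κ u κ' u' x z a b) * hsb
  · intro h x z
    have e := h ((Φ (d := d) N α).r a x) ((Φ (d := d) N α).r b z)
    rw [Pi.sub_apply, Pi.sub_apply, Pi.sub_apply, Pi.sub_apply, actB_apply] at e
    simp only [Φ_r_r] at e
    simp only [Pi.smul_apply, Pi.add_apply, smul_eq_mul, refK_apply]
    linear_combination ((Φ (d := d) N α).s a * (Φ (d := d) N α).s b * (reflSign α κ * reflSign α κ')) * e -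
      (G κ (bref α κ u) κ' (bref α κ' u') x z a b * ((reflSign α κ' * reflSign α κ') *
        (((Φ (d := d) N α).s a * (Φ (d := d) N α).s a) * ((Φ (d := d) N α).s b * (Φ (d := d) N α).s b)))) * hκ -
      (G κ (bref α κ u) κ' (bref α κ' u') x z a b * (((Φ (d := d) N α).s a * (Φ (d := d) N α).s a) *
        ((Φ (d := d) N α).s b * (Φ (d := d) N α).s b))) * hκ' -
      (G κ (bref α κ u) κ' (bref α κ' u') x z a b * ((Φ (d := d) N α).s b * (Φ (d := d) N α).s b)) * hsa -
      G κ (bref α κ u) κ' (bref α κ' u') x z a b * hsb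

/-! ## §4 The canonical contact of a first-order datum and its anti-invariance -/

/-- [our object] **THE CANONICAL SECOND-ORDER CONTACT** of a first-order datum `(𝕄, S, g)` (effective bordered operator, first-order stencil
family, diagonal generator symbols): `canonD 𝕄 S g κ u κ′ u′ := conjW 𝕄 (S κ u) (S κ′ u′) (diagK (g κ u)) (diagK (g κ′ u′)) (diagK (g κ u · g κ′ u′))`. -/
def canonD (𝕄 : MKer (d + 1) (Fib d)) (S : Fin (d + 1) → (Fin (d + 1) → ℤ) → MKer (d + 1) (Fib d)) (g : Fin (d + 1) → (Fin (d + 1) → ℤ) → (Fin (d + 1) → ℤ) → Fib d → ℝ) : Fin (d + 1) → (Fin (d + 1) → ℤ) → Fin (d + 1) → (Fin (d + 1) → ℤ) → MKer (d + 1) (Fib d) :=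
  fun κ u κ' u' => conjW 𝕄 (S κ u) (S κ' u') (diagK (g κ u)) (diagK (g κ' u')) (diagK fun p c => g κ u p c * g κ' u' p c)

variable {N α}
variable {𝕄 : MKer (d + 1) (Fib d)} {S : Fin (d + 1) → (Fin (d + 1) → ℤ) → MKer (d + 1) (Fib d)} {g : Fin (d + 1) → (Fin (d + 1) → ℤ) → (Fin (d + 1) → ℤ) → Fib d → ℝ}

/-- [folklore] Entries of the canonical contact (gauge form): `S′·Δg + S·Δg′ + 𝕄·Δg·Δg′`. -/
theorem canonD_apply (𝕄 : MKer (d + 1) (Fib d)) (S : Fin (d + 1) → (Fin (d + 1) → ℤ) → MKer (d + 1) (Fib d)) (g : Fin (d + 1) → (Fin (d + 1) → ℤ) → (Fin (d + 1) → ℤ) → Fib d → ℝ)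
    (κ : Fin (d + 1)) (u : Fin (d + 1) → ℤ) (κ' : Fin (d + 1)) (u' x z : Fin (d + 1) → ℤ) (a b : Fib d) :
    canonD 𝕄 S g κ u κ' u' x z a b = S κ' u' x z a b * (g κ u z b - g κ u x a) + S κ u x z a b * (g κ' u' z b - g κ' u' x a) +
      𝕄 x z a b * ((g κ u z b - g κ u x a) * (g κ' u' z b - g κ' u' x a)) :=
  conjW_canon_apply 𝕄 (S κ u) (S κ' u') (g κ u) (g κ' u') x z a b

/-- [folklore] **UNDER THE FIRST-ORDER LAW THE CONTACT IS `S′·Δg + (actS S)·Δg′`** (the quadratic `𝕄`-term is absorbed: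
`𝕄·Δg = actS S − S` entrywise). -/
theorem canonD_eq_of_law (hS : actS N α S = fun κ u => S κ u + conjV 𝕄 (diagK (g κ u)))
    (κ : Fin (d + 1)) (u : Fin (d + 1) → ℤ) (κ' : Fin (d + 1)) (u' x z : Fin (d + 1) → ℤ) (a b : Fib d) :
    canonD 𝕄 S g κ u κ' u' x z a b =
      S κ' u' x z a b * (g κ u z b - g κ u x a) + actS N α S κ u x z a b * (g κ' u' z b - g κ' u' x a) := by
  have e := congrFun (congrFun (congrFun (congrFun (congrFun (congrFun hS κ) u) x) z) a) b
  simp only [Pi.add_apply, conjV_diagK_apply] at e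
  rw [canonD_apply, e]; ring

/-- [folklore] The mirrored form: `(actS S)′·Δg + S·Δg′` (the two readings agree because `𝕄·Δg·Δg′ = 𝕄·Δg′·Δg`). -/
theorem canonD_eq_of_law' (hS : actS N α S = fun κ u => S κ u + conjV 𝕄 (diagK (g κ u)))
    (κ : Fin (d + 1)) (u : Fin (d + 1) → ℤ) (κ' : Fin (d + 1)) (u' x z : Fin (d + 1) → ℤ) (a b : Fib d) :
    canonD 𝕄 S g κ u κ' u' x z a b =
      actS N α S κ' u' x z a b * (g κ u z b - g κ u x a) + S κ u x z a b * (g κ' u' z b - g κ' u' x a) := by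
  have e := congrFun (congrFun (congrFun (congrFun (congrFun (congrFun hS κ') u') x) z) a) b
  simp only [Pi.add_apply, conjV_diagK_apply] at e
  rw [canonD_apply, e]; ring

/-- [folklore] **ANTI-INVARIANCE OF THE CANONICAL CONTACT**: under the first-order law in action form and an `α`-ODD generator
(`g κ (bref α κ u) (Φ.r b z) b = −ε_κ · g κ u z b` on every leg), `actB (canonD 𝕄 S g) = −canonD 𝕄 S g`.  Nothing about `𝕄` beyond the
first-order law is used. -/
theorem actB_canonD (hS : actS N α S = fun κ u => S κ u + conjV 𝕄 (diagK (g κ u)))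
    (hg : ∀ (κ : Fin (d + 1)) (u z : Fin (d + 1) → ℤ) (b : Fib d),
      g κ (bref α κ u) ((Φ (d := d) N α).r b z) b = -reflSign α κ * g κ u z b) :
    actB N α (canonD 𝕄 S g) = -canonD 𝕄 S g := by
  funext κ u κ' u' x z a b
  -- the involution `actS (actS S) = S`, read at the entry
  have hinv := congrFun (congrFun (congrFun (congrFun (congrFun (congrFun (actS_actS N α S) κ) u) x) z) a) b
  rw [actS_apply] at hinv
  -- the reflected second table is `actS S κ′ u′`
  have hV' : reflSign α κ' * ((Φ (d := d) N α).s a * (Φ (d := d) N α).s b *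
      S κ' (bref α κ' u') ((Φ (d := d) N α).r a x) ((Φ (d := d) N α).r b z) a b) = actS N α S κ' u' x z a b := by
    rw [actS_apply]
  rw [show (-canonD 𝕄 S g) κ u κ' u' x z a b = -(canonD 𝕄 S g κ u κ' u' x z a b) from rfl, actB_apply,
    canonD_eq_of_law hS κ (bref α κ u) κ' (bref α κ' u'), canonD_eq_of_law' hS κ u κ' u' x z a b,
    hg κ u, hg κ u, hg κ' u', hg κ' u', ← hV', ← hinv]
  have hκ := reflSign_mul_self α κ
  have hκ' := reflSign_mul_self α κ'
  set A := S κ' (bref α κ' u') ((Φ (d := d) N α).r a x) ((Φ (d := d) N α).r b z) a b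
  set B := actS N α S κ (bref α κ u) ((Φ (d := d) N α).r a x) ((Φ (d := d) N α).r b z) a b
  linear_combination (-(reflSign α κ' * ((Φ (d := d) N α).s a * (Φ (d := d) N α).s b) * A * (g κ u z b - g κ u x a))) * hκ -
    (reflSign α κ * ((Φ (d := d) N α).s a * (Φ (d := d) N α).s b) * B * (g κ' u' z b - g κ' u' x a)) * hκ'

/-! ## §5 The single-axis model -/

/-- [folklore] **THE SINGLE-AXIS MODEL**: if `actB D = −D` then `T := −½ • D` solves `actB T − T = D` (all entries). -/
theorem single_axis_model {D : Fin (d + 1) → (Fin (d + 1) → ℤ) → Fin (d + 1) → (Fin (d + 1) → ℤ) → MKer (d + 1) (Fib d)} (hD : actB N α D = -D) : actB N α ((-(1 / 2 : ℝ)) • D) - (-(1 / 2 : ℝ)) • D = D := by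
  rw [actB_smul, hD, smul_neg, neg_smul, neg_neg, sub_neg_eq_add, ← add_smul]
  norm_num

/-- [folklore] **ALL SOLUTIONS**: `T` solves `actB T − T = D` iff `T − (−½ • D)` is `actB`-invariant (given `actB D = −D`). -/
theorem solution_iff {D T : Fin (d + 1) → (Fin (d + 1) → ℤ) → Fin (d + 1) → (Fin (d + 1) → ℤ) → MKer (d + 1) (Fib d)} (hD : actB N α D = -D) : actB N α T - T = D ↔ actB N α (T - (-(1 / 2 : ℝ)) • D) = T - (-(1 / 2 : ℝ)) • D := by
  have h1 := single_axis_model (N := N) (α := α) hD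
  have key : actB N α (T - (-(1 / 2 : ℝ)) • D) - (T - (-(1 / 2 : ℝ)) • D) = (actB N α T - T) - D := by
    conv_rhs => rw [← h1]
    rw [actB_sub]; abel
  constructor
  · intro h
    exact sub_eq_zero.mp (by rw [key, h, sub_self])
  · intro h
    have e : actB N α (T - (-(1 / 2 : ℝ)) • D) - (T - (-(1 / 2 : ℝ)) • D) = 0 := sub_eq_zero.mpr h
    rwa [key, sub_eq_zero] at e


end

end Summit.QuantumFields.BalabanUV.Beta.SecondOrderBorderGauge
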